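import Summits.QuantumFields.BalabanUV.T4Continuum.Support.NE7FlatHkOrthogonal
import Summits.QuantumFields.BalabanUV.T4Continuum.Support.NE3CoercivityScaling
import HarnessLib

/-!
# NE7TorusBoxDictionaryDiv — the box ↔ cubic-torus dictionary, DIVERGENCE ENTRY: the flat backward divergence of a periodic T4 field, entrywise, IS (minus, `conj c` times) lit-balaban's
# `∂*` ([B5] (1.21)) of its torus restriction; and the coefficient scaling `divS N c = conj c·divS N 1` (`Fs N c = c·Fs N 1` is `NE7FlatHkOrthogonal.Fs_eq_mul_Fs_one`) (companion of `NE7TorusBoxDictionary.curlAt_flat_entry_torus`)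

Cell `pub-balaban`, rung (B)+1 sub-cell t4, lineage `b2b-balaban-t4-ne7b-p1`, generation 150 (OWNER of BINDER row NE7b; junction service for the NE crew, ruling R-OWNER-149-1 (2)).
A JUNCTION for row NE7 (node U5): the flat torus letter `NE7FlatTangentSupCurlDiv.tangent_sup_flat` (this seat, p764142: `QvOp x = 0 ⟹ ‖x‖_∞ ≤ K·sup‖Fs x‖ + K′·sup‖(1 − Π′)∂ᴴx‖`) is
read on T4's `Site d`-periodic carriers in the bootstrap of memo ROAD-G100 §4 (steps (4)–(5)) through the entrywise dictionary of t4-ne7-p1 gen 70∕72∕73 (`NE7TorusBoxDictionary`: a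
`P`-periodic `Y` reads through `rep ∘ toT`; `curlAt_flat_entry_torus` for the plaquette field; `NE7FlatAverageBridge.linQ_pullback_eq` for the straight average).  The divergence hypothesis
of the letter needs the matching entry, THIS FILE: `(flatDiv Y z) i i′ = −divS (P,…,P) 1 (p ↦ Y (rep p.1) p.2 i i′) (toT z)` (`divS c A x = Σ_μ conj c (A(x − e_μ, μ) − A(x, μ))`,
`B5Action121.divS_apply`; `flatDiv X x = Σ_μ (X x μ − X (x − e_μ) μ)`, `NE3CoercivityScaling.flatDiv` = `covDiv flatCfg` by `NE3FrameFreeSliceUnique.covDiv_flatCfg_eq_flatDiv`), together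
with the `GradOpᴴ` form (`B5Action121.GradOp_conjTranspose_mulVec`) and the coefficient scalings that move between the unit reading `c = 1` and the η-reading `c = n` of
`Tor (fine n M)`.
WHAT ([folklore]; 0 def, 0 sorry; every dimension `d`, cubic torus `(P,…,P)`, `P ≥ 1`).
§1 `toT_sub_e'` (`toT (x − e_μ) = toT x − unitVec μ`), `divS_coeff` (`divS N c A x = conj c·divS N 1 A x`), `gradOpH_mulVec_coeff`.
§2 **`flatDiv_entry_torus`** (`divS (P,…,P) c (p ↦ Y (rep p.1) p.2 i i′) (toT z) = −conj c·(flatDiv Y z) i i′`), **`gradOpH_entry_torus`** (the same for `((GradOp (P,…,P) c)ᴴ *ᵥ ·) (toT z)`),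
   `curlAt_flat_entry_torus_coeff` (`Fs (P,…,P) c (…) μ ν (toT z) = c·(curlAt flat Y z μ ν) i i′`).
HONEST FRAMING (page 1): index bookkeeping; nothing of Bałaban's asserted ([B5] (1.2), (1.21) are text locations); NOT the curved letter, NOT (S1), NOT NE7, nothing of row NE7b; spine 0∕9;
finite T⁴ rung (B)+1 — NOT infinite volume, NOT mass gap, NOT BetaPertH, NOT Clay.  Continuum YM on T⁴ ⇐ BetaPertH ∧ nine spine estimates (0/9 proved); BetaPertH ⇐ (D1) ∧ (D4) ∧ CAP+tail;
G-an2-4 gates asym, D1 and NE2/3/4.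
-/

set_option autoImplicit false

open scoped BigOperators Matrix ComplexConjugate
open Finset

namespace Summit.QuantumFields.BalabanUV.T4Continuum.NE7TorusBoxDictionaryDiv

open Literature.MathematicalPhysics.QuantumFieldTheory.Balaban1983to89
open B7Prop1Explicit B7Prop2Explicit
open B5Prop11Plancherel (Tor unitVec)
open B5Action121 (Fs Fs_apply divS divS_apply GradOp GradOp_conjTranspose_mulVec)
open B6LowerBound2153Torus (toT rep)
open AveragingDeficitPeriodicCounting (IsPeriodicDir)
open BlockAveragePushDirSplit (flat)
open T4AveragingDeficitWall (curlAt)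
open NE3CoercivityScaling (flatDiv)
open NE7TorusBoxDictionary (toT_add_e' apply_rep_toT' curlAt_flat_entry_torus)
open NE7FlatHkOrthogonal (Fs_eq_mul_Fs_one)

noncomputable section

variable {d : ℕ} {n : Type*} [Fintype n] [DecidableEq n]

/-! ## §1 Elementary: a backward step on the torus, and the coefficient scalings of `Fs`, `divS`, `∂ᴴ` -/

omit [Fintype n] [DecidableEq n] in
/-- `toT (x − e_μ) = toT x − unitVec μ`. [folklore] -/
theorem toT_sub_e' (N : Fin d → ℕ) (x : Site d) (μ : Fin d) : toT N (x - e μ) = toT N x - unitVec N μ := by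
  rw [eq_sub_iff_add_eq, ← toT_add_e', sub_add_cancel]

omit [Fintype n] [DecidableEq n] in
/-- `divS N c A = conj c·divS N 1 A` pointwise. [folklore] -/
theorem divS_coeff (N : Fin d → ℕ) [∀ μ, NeZero (N μ)] (c : ℂ) (A : Tor N × Fin d → ℂ) (x : Tor N) :
    divS N c A x = conj c * divS N 1 A x := by
  rw [divS_apply, divS_apply, map_one, Finset.mul_sum]
  simp only [one_mul]

omit [Fintype n] [DecidableEq n] in
/-- `((GradOp N c)ᴴ A)(y) = conj c·((GradOp N 1)ᴴ A)(y)`. [folklore] -/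
theorem gradOpH_mulVec_coeff (N : Fin d → ℕ) [∀ μ, NeZero (N μ)] (c : ℂ) (A : Tor N × Fin d → ℂ) (y : Tor N) :
    ((GradOp N c)ᴴ *ᵥ A) y = conj c * ((GradOp N 1)ᴴ *ᵥ A) y := by
  rw [GradOp_conjTranspose_mulVec, GradOp_conjTranspose_mulVec, divS_coeff]

/-! ## §2 The divergence entry of the dictionary (and the curl entry with a general coefficient) -/

omit [Fintype n] [DecidableEq n] in
/-- **THE FLAT BACKWARD DIVERGENCE OF A PERIODIC FIELD, ENTRYWISE, IS `−conj c`·lit-balaban's `∂*` OF ITS TORUS RESTRICTION**: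
`divS (P,…,P) c (p ↦ Y (rep p.1) p.2 i i′) (toT z) = −conj c·(flatDiv Y z) i i′` for a `P`-periodic `Y` (`P ≥ 1`). [folklore] -/
theorem flatDiv_entry_torus {P : ℕ} [NeZero P] {Y : Site d → Fin d → Matrix n n ℂ} (hYP : IsPeriodicDir Y (P : ℤ)) (c : ℂ)
    (z : Site d) (i i' : n) :
    divS (fun _ : Fin d => P) c (fun p : Tor (fun _ : Fin d => P) × Fin d => Y (rep (fun _ : Fin d => P) p.1) p.2 i i') (toT (fun _ : Fin d => P) z)
      = -(conj c) * flatDiv Y z i i' := by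
  rw [divS_apply]
  simp only [← toT_sub_e', apply_rep_toT' hYP]
  rw [flatDiv, Matrix.sum_apply, Finset.mul_sum]
  refine Finset.sum_congr rfl fun μ _ => ?_
  rw [Matrix.sub_apply]
  ring

omit [Fintype n] [DecidableEq n] in
/-- **THE SAME FOR `∂ᴴ = (GradOp)ᴴ`** (the form `NE7FlatTangentSupCurlDiv.tangent_sup_flat` consumes):
`((GradOp (P,…,P) c)ᴴ *ᵥ (p ↦ Y (rep p.1) p.2 i i′)) (toT z) = −conj c·(flatDiv Y z) i i′`. [folklore] -/
theorem gradOpH_entry_torus {P : ℕ} [NeZero P] {Y : Site d → Fin d → Matrix n n ℂ} (hYP : IsPeriodicDir Y (P : ℤ)) (c : ℂ)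
    (z : Site d) (i i' : n) :
    ((GradOp (fun _ : Fin d => P) c)ᴴ *ᵥ (fun p : Tor (fun _ : Fin d => P) × Fin d => Y (rep (fun _ : Fin d => P) p.1) p.2 i i'))
        (toT (fun _ : Fin d => P) z)
      = -(conj c) * flatDiv Y z i i' := by
  rw [GradOp_conjTranspose_mulVec, flatDiv_entry_torus hYP]

/-- The curl entry with a general coefficient: `Fs (P,…,P) c (p ↦ Y (rep p.1) p.2 i i′) μ ν (toT z) = c·(curlAt flat Y z μ ν) i i′`. [folklore] -/
theorem curlAt_flat_entry_torus_coeff {P : ℕ} [NeZero P] {Y : Site d → Fin d → Matrix n n ℂ} (hYP : IsPeriodicDir Y (P : ℤ)) (c : ℂ)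
    (z : Site d) (μ ν : Fin d) (i i' : n) :
    Fs (fun _ : Fin d => P) c (fun p : Tor (fun _ : Fin d => P) × Fin d => Y (rep (fun _ : Fin d => P) p.1) p.2 i i') μ ν (toT (fun _ : Fin d => P) z)
      = c * curlAt (flat (d := d) (n := n)) Y z μ ν i i' := by
  rw [Fs_eq_mul_Fs_one, curlAt_flat_entry_torus hYP]

end

end Summit.QuantumFields.BalabanUV.T4Continuum.NE7TorusBoxDictionaryDiv
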